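import Summits.QuantumFields.GaugeBoot.StrongCouplingSecondOrderPieces
import HarnessLib

/-!
# Strong coupling from the loop equation: `E[(tr U_P)²]`, `E[tr U_P²]`, `E|tr U_P|² − 1` are `O(β²)` for `SU(N)`, `N ≥ 4` (gauge-boot, ADDENDUM 25 part E)

HONEST FRAMING (cell `pub-gaugeboot`, page 1 of every file): the venture produces certified bounds
on lattice expectations at stated coupling, gauge group, dimension and torus size; NOT a mass gap,
NOT a continuum limit, NOT a string tension; NOT Yang–Mills-summit-bearing (barriers
`FixedCouplingUltralocality`, `PerturbativeInvisibility`).  Crude explicit bounds on a finite torus `(ℤ/L)^d`,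
`L ≥ 2`, every real (tree) coupling `β = β_std/N`; no number of the cell's tables is certified here.

## Content

The level-2 quantities of the strong-coupling expansion of the `SU(N)` plaquette, `a = E[(tr U_P)²]`, `b = E[tr U_P²]`,
`m = E|tr U_P|²`, obey (ADDENDUM 22) `(N − 2/N)b + a = −(β/2)r₂`, `(N − 2/N)a + b = −(β/2)r₁`, `N(m − 1) = −(β/2)r₃`,
and the right sides are `O(β)` for `N ≥ 4` (`StrongCouplingSecondOrderPieces`).  Hence, for `SU(N)`, `N ≥ 4`, every
`L ≥ 2`, `d ≥ 2` and every real `β`: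

* ★★ `norm_integral_trace_mul_trace_reverse_sub_one_suN_le₂` — **`‖E|tr U_P|² − 1‖ ≤ (18d − 9)(d−1)β²`**;
* ★★ `norm_integral_trace_sq_suN_le₂` — **`‖E[(tr U_P)²]‖ ≤ (28d + 38)(d−1)β²`**;
* ★★ `norm_integral_trace_double_suN_le₂` — **`‖E[tr U_P²]‖ ≤ (23N + 13d)(d−1)β²`**.
Their Haar values vanish for `N ≥ 3` (`∫(tr U)² = ∫ tr U² = 0`, `∫|tr U|² = 1`) and, for `N ≥ 4`, so do their
first-order coefficients — unlike `SU(3)`, where `a = β/2 + O(β²)`, `b = −β/2 + O(β²)` feed the coefficient `1/216`.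
The assembly into the plaquette expectation through third order is `StrongCouplingPlaquetteSUNThird`.

References: Yu. Makeenko, *Methods of contemporary gauge theory* (2002) Problem 12.7; J.-M. Drouffe, J.-B. Zuber,
Phys. Rept. 102 (1983) §3.  Everything is `[folklore]`.
-/

noncomputable section

open MeasureTheory Filter Topology NormedSpace
open scoped Matrix.Norms.Frobenius Matrix ComplexConjugate
open Literature.MathematicalPhysics.QuantumFieldTheory Literature.MathematicalPhysics.QuantumLattice
open Summit.QuantumFields.YangMills.Cruxes.CurvatureAmnesia.WardDefect.SchwingerDyson

namespace Summit.QuantumFields.GaugeBoot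

namespace StrongCoupling

variable {d L N : ℕ} [NeZero L]

/-! ## `m − 1 = O(β²)` -/

/-- ★★ **`‖E[tr U_P · tr U_P⁻¹] − 1‖ ≤ (18d − 9)(d−1)β²`** (`SU(N)`, `N ≥ 4`, every `L ≥ 2`, every real `β`): the
reverse-spectator identity `N(m − 1) = −(β/2)r₃` with `‖r₃‖ ≤ (36d − 18)N(d−1)|β|`. [folklore] -/
theorem norm_integral_trace_mul_trace_reverse_sub_one_suN_le₂ (hN : 4 ≤ N) (hL : (1 : ZMod L) ≠ 0) (β : ℝ) (x : Site d L)
    {μ ν₀ : Fin d} (hμν₀ : μ ≠ ν₀) :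
    ‖(∫ U, (fundamentalRep (Fin N) (wordHolonomy U x (plaqWord μ ν₀ true))).trace *
        (fundamentalRep (Fin N) (wordHolonomy U x (plaqWord μ ν₀ true).reverse)).trace
          ∂(wilsonMeasure (d := d) (L := L) (fundamentalRep (Fin N)) β)) - 1‖ ≤ (18 * (d : ℝ) - 9) * ((d : ℝ) - 1) * β ^ 2 := by
  have hN4 : (4 : ℝ) ≤ N := by exact_mod_cast hN
  have hNpos : (0 : ℝ) < N := by linarith
  have hd1 : (0 : ℝ) ≤ (d : ℝ) - 1 := sub_one_nonneg_of_axis μ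
  have h := spectator_reverse_identity (d := d) (L := L) (fundamentalLatticeRep N) hL β x hμν₀ 1
    fun i j => sdPair₂_specialUnitaryGroup N β x μ x _ x _ _ (trace_unitDir_one i j)
  simp only [fundamentalLatticeRep_N] at h
  have h' : (N : ℂ) * ((∫ U, (fundamentalRep (Fin N) (wordHolonomy U x (plaqWord μ ν₀ true))).trace *
      (fundamentalRep (Fin N) (wordHolonomy U x (plaqWord μ ν₀ true).reverse)).trace
        ∂(wilsonMeasure (d := d) (L := L) (fundamentalRep (Fin N)) β)) - 1) =
      -((β / 2 : ℂ) * ∑ ν ∈ Finset.univ.erase μ, ∑ ε : Bool,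
        ∫ U, plaqTerm (fundamentalRep (Fin N)) 1 x μ U (plaqWord μ ν₀ true) ν ε *
          (fundamentalRep (Fin N) (wordHolonomy U x (plaqWord μ ν₀ true).reverse)).trace
            ∂(wilsonMeasure (d := d) (L := L) (fundamentalRep (Fin N)) β)) := by
    rw [mul_sub, mul_one]; exact h
  have hR := norm_reverseSpectatorSum_suN_le (d := d) (L := L) hN hL β x hμν₀
  have key := congrArg (fun z : ℂ => ‖z‖) h'
  simp only [norm_mul, norm_neg, Complex.norm_natCast, norm_half_ofReal] at key
  have hmain := mul_le_mul_of_nonneg_left hR (by positivity : (0 : ℝ) ≤ |β| / 2)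
  rw [← key] at hmain
  rw [← mul_le_mul_iff_of_pos_left hNpos]
  refine hmain.trans (le_of_eq ?_)
  rw [← sq_abs β]; ring

/-! ## `a, b = O(β²)` -/

omit [NeZero L] in
/-- The `2×2` system `k·b + a = ρ₂`, `k·a + b = ρ₁` with `k > 1`: `(k² − 1)‖a‖ ≤ k‖ρ₁‖ + ‖ρ₂‖` and
`(k² − 1)‖b‖ ≤ k‖ρ₂‖ + ‖ρ₁‖`. [folklore] -/
theorem two_by_two_norm_le' {k : ℝ} (hk : 1 < k) {a b ρ₁ ρ₂ : ℂ} (h2 : (k : ℂ) * b + a = ρ₂) (h1 : (k : ℂ) * a + b = ρ₁) :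
    (k ^ 2 - 1) * ‖a‖ ≤ k * ‖ρ₁‖ + ‖ρ₂‖ ∧ (k ^ 2 - 1) * ‖b‖ ≤ k * ‖ρ₂‖ + ‖ρ₁‖ := by
  have hk1 : 0 < k ^ 2 - 1 := by nlinarith
  have e1 : ((k ^ 2 - 1 : ℝ) : ℂ) * a = (k : ℂ) * ρ₁ - ρ₂ := by push_cast; linear_combination (k : ℂ) * h1 - h2
  have e2 : ((k ^ 2 - 1 : ℝ) : ℂ) * b = (k : ℂ) * ρ₂ - ρ₁ := by push_cast; linear_combination (k : ℂ) * h2 - h1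
  have n1 := congrArg (fun z : ℂ => ‖z‖) e1
  have n2 := congrArg (fun z : ℂ => ‖z‖) e2
  simp only [norm_mul, Complex.norm_real, Real.norm_eq_abs, abs_of_pos hk1] at n1 n2
  have hkn : ‖(k : ℂ)‖ = k := by rw [Complex.norm_real, Real.norm_eq_abs, abs_of_pos (by linarith)]
  constructor
  · rw [n1]; refine (norm_sub_le _ _).trans (le_of_eq ?_); rw [norm_mul, hkn]
  · rw [n2]; refine (norm_sub_le _ _).trans (le_of_eq ?_); rw [norm_mul, hkn]

omit [NeZero L] in
/-- Rounding for `a`: `k(36d+21)N + 32N² + 36d − 54 ≤ (k²−1)·2(28d+38)` with `kN = N² − 2`, `N ≥ 4`, `d ≥ 1`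
(multiplied by `N²`). [folklore] -/
theorem poly_aux₃ (N D : ℝ) (hN : 4 ≤ N) (hD : 1 ≤ D) :
    (N ^ 2 - 2) * ((36 * D + 21) * N) * N + (32 * N ^ 2 + 36 * D - 54) * N ^ 2 ≤
      ((N ^ 2 - 2) ^ 2 - N ^ 2) * (2 * (28 * D + 38)) := by
  have h16 : 0 ≤ N ^ 2 - 16 := by nlinarith
  have hD0 : 0 ≤ D := by linarith
  nlinarith [mul_nonneg (mul_nonneg (sq_nonneg N) h16) hD0, mul_nonneg (sq_nonneg N) h16, mul_nonneg h16 hD0,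
    mul_nonneg (mul_nonneg h16 h16) hD0, mul_nonneg h16 h16]

omit [NeZero L] in
/-- Rounding for `b`: `k(32N² + 36d − 54) + (36d+21)N ≤ (k²−1)·2(23N + 13d)` (multiplied by `N²`). [folklore] -/
theorem poly_aux₄ (N D : ℝ) (hN : 4 ≤ N) (hD : 1 ≤ D) :
    (N ^ 2 - 2) * (32 * N ^ 2 + 36 * D - 54) * N + (36 * D + 21) * N * N ^ 2 ≤
      ((N ^ 2 - 2) ^ 2 - N ^ 2) * (2 * (23 * N + 13 * D)) := by
  have h16 : 0 ≤ N ^ 2 - 16 := by nlinarith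
  have hD0 : 0 ≤ D := by linarith
  have hN0 : 0 ≤ N := by linarith
  nlinarith [mul_nonneg (mul_nonneg (sq_nonneg N) h16) hD0, mul_nonneg (mul_nonneg hN0 h16) hD0,
    mul_nonneg (mul_nonneg (sq_nonneg N) h16) hN0, mul_nonneg h16 hD0, mul_nonneg (mul_nonneg h16 h16) hN0,
    mul_nonneg h16 hN0]

/-- ★★ **`a = E[(tr U_P)²]` and `b = E[tr U_P²]` are `O(β²)`** (`SU(N)`, `N ≥ 4`, every `L ≥ 2`, every real `β`):
`‖E[(tr U_P)²]‖ ≤ (28d + 38)(d−1)β²` and `‖E[tr U_P²]‖ ≤ (23N + 13d)(d−1)β²`. [folklore] -/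
theorem secondMoments_suN_le₂ (hN : 4 ≤ N) (hL : (1 : ZMod L) ≠ 0) (β : ℝ) (x : Site d L) {μ ν₀ : Fin d} (hμν₀ : μ ≠ ν₀) :
    ‖∫ U, (fundamentalRep (Fin N) (wordHolonomy U x (plaqWord μ ν₀ true))).trace *
        (fundamentalRep (Fin N) (wordHolonomy U x (plaqWord μ ν₀ true))).trace
          ∂(wilsonMeasure (d := d) (L := L) (fundamentalRep (Fin N)) β)‖ ≤ (28 * (d : ℝ) + 38) * ((d : ℝ) - 1) * β ^ 2 ∧
    ‖∫ U, (fundamentalRep (Fin N) (wordHolonomy U x (plaqWord μ ν₀ true ++ plaqWord μ ν₀ true))).trace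
          ∂(wilsonMeasure (d := d) (L := L) (fundamentalRep (Fin N)) β)‖ ≤ (23 * (N : ℝ) + 13 * d) * ((d : ℝ) - 1) * β ^ 2 := by
  have hN4 : (4 : ℝ) ≤ N := by exact_mod_cast hN
  have hNpos : (0 : ℝ) < N := by linarith
  have hd1 : (0 : ℝ) ≤ (d : ℝ) - 1 := sub_one_nonneg_of_axis μ
  have hd : (1 : ℝ) ≤ d := by linarith
  have h2 := doublyWound_identity (d := d) (L := L) (fundamentalLatticeRep N) hL β x hμν₀ 1
    fun i j => sdPair_specialUnitaryGroup N β x μ x _ _ (trace_unitDir_one i j)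
  have h1 := spectator_self_identity (d := d) (L := L) (fundamentalLatticeRep N) hL β x hμν₀ 1
    fun i j => sdPair₂_specialUnitaryGroup N β x μ x _ x _ _ (trace_unitDir_one i j)
  simp only [fundamentalLatticeRep_N, fundamentalLatticeRep_ρ] at h1 h2
  set a := ∫ U, (fundamentalRep (Fin N) (wordHolonomy U x (plaqWord μ ν₀ true))).trace *
        (fundamentalRep (Fin N) (wordHolonomy U x (plaqWord μ ν₀ true))).trace
          ∂(wilsonMeasure (d := d) (L := L) (fundamentalRep (Fin N)) β) with ha
  set b := ∫ U, (fundamentalRep (Fin N) (wordHolonomy U x (plaqWord μ ν₀ true ++ plaqWord μ ν₀ true))).trace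
          ∂(wilsonMeasure (d := d) (L := L) (fundamentalRep (Fin N)) β) with hb
  set r₁ := ∑ ν ∈ Finset.univ.erase μ, ∑ ε : Bool, ∫ U, plaqTerm (fundamentalRep (Fin N)) 1 x μ U (plaqWord μ ν₀ true) ν ε *
        (fundamentalRep (Fin N) (wordHolonomy U x (plaqWord μ ν₀ true))).trace
          ∂(wilsonMeasure (d := d) (L := L) (fundamentalRep (Fin N)) β) with hr₁
  set r₂ := ∑ ν ∈ Finset.univ.erase μ, ∑ ε : Bool, ∫ U, plaqTerm (fundamentalRep (Fin N)) 1 x μ U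
        (plaqWord μ ν₀ true ++ plaqWord μ ν₀ true) ν ε ∂(wilsonMeasure (d := d) (L := L) (fundamentalRep (Fin N)) β) with hr₂
  have h2' : ((N : ℂ) - 2 * 1 / N) * b + a = -((β / 2 : ℂ) * r₂) := h2
  have h1' : ((N : ℂ) - 2 * 1 / N) * a + b = -((β / 2 : ℂ) * r₁) := h1
  have hR1 := norm_selfSpectatorSum_suN_le (d := d) (L := L) hN hL β x hμν₀
  have hR2 := norm_doubleSum_suN_le (d := d) (L := L) hN hL β x hμν₀
  rw [← hr₁] at hR1
  rw [← hr₂] at hR2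
  set k : ℝ := ((N : ℝ) ^ 2 - 2) / N with hk
  have hkN : k * N = (N : ℝ) ^ 2 - 2 := by rw [hk]; field_simp
  have hk1 : 1 < k := by rw [hk, lt_div_iff₀ hNpos]; nlinarith
  have hkpos : 0 < k := by linarith
  have hk21 : 0 < k ^ 2 - 1 := by nlinarith
  have hkC : ((N : ℂ) - 2 * 1 / N) = (k : ℂ) := by
    have : (N : ℂ) ≠ 0 := by exact_mod_cast hNpos.ne'
    rw [hk]; push_cast; field_simp
  rw [hkC] at h1' h2'
  obtain ⟨hab, hbb⟩ := two_by_two_norm_le' hk1 h2' h1'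
  have hβ2 : ‖(β / 2 : ℂ)‖ = |β| / 2 := norm_half_ofReal β
  have nρ1 : ‖-((β / 2 : ℂ) * r₁)‖ ≤ |β| / 2 * ((36 * (d : ℝ) + 21) * N * ((d : ℝ) - 1) * |β|) := by
    rw [norm_neg, norm_mul, hβ2]; exact mul_le_mul_of_nonneg_left hR1 (by positivity)
  have nρ2 : ‖-((β / 2 : ℂ) * r₂)‖ ≤ |β| / 2 * ((32 * (N : ℝ) ^ 2 + 36 * (d : ℝ) - 54) * ((d : ℝ) - 1) * |β|) := by
    rw [norm_neg, norm_mul, hβ2]; exact mul_le_mul_of_nonneg_left hR2 (by positivity)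
  have hY : 0 ≤ ((d : ℝ) - 1) * β ^ 2 := by positivity
  have hb2 : |β| * |β| = β ^ 2 := by rw [← sq, sq_abs]
  constructor
  · have h := hab.trans (add_le_add (mul_le_mul_of_nonneg_left nρ1 hkpos.le) nρ2)
    -- `(k²−1)‖a‖ ≤ (|β|²/2)(d−1)[k(36d+21)N + 32N² + 36d − 54]`
    have h' : (k ^ 2 - 1) * ‖a‖ ≤ (k * ((36 * (d : ℝ) + 21) * N) + (32 * (N : ℝ) ^ 2 + 36 * (d : ℝ) - 54)) / 2 *
        (((d : ℝ) - 1) * β ^ 2) := by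
      refine h.trans (le_of_eq ?_); rw [← hb2]; ring
    have hpoly : (k * ((36 * (d : ℝ) + 21) * N) + (32 * (N : ℝ) ^ 2 + 36 * (d : ℝ) - 54)) / 2 ≤
        (k ^ 2 - 1) * (28 * (d : ℝ) + 38) := by
      rw [div_le_iff₀ (by norm_num : (0 : ℝ) < 2), ← mul_le_mul_iff_of_pos_right (by positivity : (0 : ℝ) < (N : ℝ) ^ 2)]
      have e1 : (k * ((36 * (d : ℝ) + 21) * N) + (32 * (N : ℝ) ^ 2 + 36 * (d : ℝ) - 54)) * (N : ℝ) ^ 2 =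
          (k * N) * ((36 * (d : ℝ) + 21) * N) * N + (32 * (N : ℝ) ^ 2 + 36 * (d : ℝ) - 54) * (N : ℝ) ^ 2 := by ring
      have e2 : (k ^ 2 - 1) * (28 * (d : ℝ) + 38) * 2 * (N : ℝ) ^ 2 = ((k * N) ^ 2 - (N : ℝ) ^ 2) * (2 * (28 * (d : ℝ) + 38)) := by
        ring
      rw [e1, e2, hkN]
      exact poly_aux₃ N d hN4 hd
    have h'' := h'.trans (mul_le_mul_of_nonneg_right hpoly hY)
    rw [mul_assoc] at h''
    refine (le_of_mul_le_mul_left h'' hk21).trans (le_of_eq ?_); ring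
  · have h := hbb.trans (add_le_add (mul_le_mul_of_nonneg_left nρ2 hkpos.le) nρ1)
    have h' : (k ^ 2 - 1) * ‖b‖ ≤ (k * (32 * (N : ℝ) ^ 2 + 36 * (d : ℝ) - 54) + (36 * (d : ℝ) + 21) * N) / 2 *
        (((d : ℝ) - 1) * β ^ 2) := by
      refine h.trans (le_of_eq ?_); rw [← hb2]; ring
    have hpoly : (k * (32 * (N : ℝ) ^ 2 + 36 * (d : ℝ) - 54) + (36 * (d : ℝ) + 21) * N) / 2 ≤
        (k ^ 2 - 1) * (23 * (N : ℝ) + 13 * d) := by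
      rw [div_le_iff₀ (by norm_num : (0 : ℝ) < 2), ← mul_le_mul_iff_of_pos_right (by positivity : (0 : ℝ) < (N : ℝ) ^ 2)]
      have e1 : (k * (32 * (N : ℝ) ^ 2 + 36 * (d : ℝ) - 54) + (36 * (d : ℝ) + 21) * N) * (N : ℝ) ^ 2 =
          (k * N) * (32 * (N : ℝ) ^ 2 + 36 * (d : ℝ) - 54) * N + (36 * (d : ℝ) + 21) * N * (N : ℝ) ^ 2 := by ring
      have e2 : (k ^ 2 - 1) * (23 * (N : ℝ) + 13 * d) * 2 * (N : ℝ) ^ 2 = ((k * N) ^ 2 - (N : ℝ) ^ 2) * (2 * (23 * (N : ℝ) + 13 * d)) := by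
        ring
      rw [e1, e2, hkN]
      exact poly_aux₄ N d hN4 hd
    have h'' := h'.trans (mul_le_mul_of_nonneg_right hpoly hY)
    rw [mul_assoc] at h''
    refine (le_of_mul_le_mul_left h'' hk21).trans (le_of_eq ?_); ring

end StrongCoupling

end Summit.QuantumFields.GaugeBoot

end
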